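import Mathlib
import Literature.MathematicalPhysics.StatisticalMechanics.LennardJonesClusters
import Literature.MathematicalPhysics.StatisticalMechanics.LennardJonesThermodynamicLimitProofs
import Literature.Barriers.AtomisticToContinuum.StickySphereClustersNarrow
import Summits.AtomisticToContinuum.Crystallization.Theorems.ChargedEnergyGap.Negative.Unconditional
import HarnessLib

/-!
# Reflection doubling for Lennard-Jones configurations: extremal caps of ground states are thin

Helper file of line `Sketch`, crux `LjLaminarWindows` (stmt-AtomisticToContinuum-6711), towards the
cohesion input `stub_noFoam` (≡ stmt-AtomisticToContinuum-13453).

**Reflection doubling.** Let `x : Fin N → ℝᵈ` be injective, `u` a unit vector, `h ≥ ⟪x_i, u⟫` for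
all `i` (a supporting height) and `t_i = h - ⟪x_i, u⟫ ≥ 0` the depth of particle `i` below the
supporting plane.  The copy `x'_i = x_i + (1 + 2 t_i) u` (reflection in the plane `⟪·, u⟫ = h`
followed by the unit lift `+u`) is congruent to `x` (`surgery_reflect_dist_eq`), every cross
distance satisfies `|x_i - x'_j| ≥ 1 + t_i + t_j ≥ 1` (`surgery_reflect_cross_ge`), so `x ∪ x'`
consists of `2N` distinct points, all cross terms are `≤ 0`, and particle `i` faces its own image
at distance exactly `1 + 2 t_i`, where `V_LJ` is increasing.  Hence
(`surgery_reflectionDoubling_le`, `surgery_reflectionDoubling`)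

  `E(2N) ≤ 2 𝓔(x) + m_ε(u) · V_LJ(1 + 2ε)`,  `m_ε(u) = #{i : ⟪x_j, u⟫ ≤ ⟪x_i, u⟫ + ε ∀ j}`

(the population of the depth-`ε` cap in direction `u`; this is the statement `ReflectionDoubling`
of route `SurfaceTensionNoFoam`, item stmt-AtomisticToContinuum-13452, proved here as a helper).
For a GROUND STATE `x` (`𝓔(x) = E(N)`) and `E(2N) ≥ 2N e*` (`e* = ⨅_Q e(Q)`, periodisation,
`eStar_le_groundStateEnergy_div`) this prices every cap:

  `m_ε(u) · |V_LJ(1 + 2ε)| ≤ 2 (E(N) - N e*)`  (`surgery_cap_card_mul_le`),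

uniformly in the direction `u`; since `E(N)/N → e*` (`crysEnergyLimit`), **the depth-`ε` caps of a
sequence of Lennard-Jones ground states carry a vanishing fraction of the particles, in every
(possibly `N`-dependent) direction** (`surgery_cap_density_tendsto_zero`): ground states are not
films of bounded thickness, and more generally have no macroscopic flat facet population at any
fixed depth.  All statements `[folklore]` (Blanc–Lewin 2015, §1.2–1.3: two copies attract).
-/

noncomputable section

open scoped BigOperators InnerProductSpace
open Filter Topology
open Literature.MathematicalPhysics.StatisticalMechanics
open Literature.Barriers.AtomisticToContinuum (strictMonoOn_lennardJones)
open Summit.AtomisticToContinuum.Crystallization.Theorems.ChargedEnergyGapNegative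
  (eStar eStar_le_groundStateEnergy_div crysEnergyLimit)

namespace Summit.AtomisticToContinuum.Crystallization.Theorems.LjLaminarWindowsSketch

variable {d N : ℕ}

/-! ## The reflected-and-lifted copy: elementary geometry -/

/-- **The copy is congruent.** For a unit vector `u` and any `h`, the map
`a ↦ a + (1 + 2(h - ⟪a, u⟫)) u` (reflection in the plane `⟪·, u⟫ = h`, then the lift `+u`)
preserves distances. [folklore] -/
theorem surgery_reflect_dist_eq {F : Type*} [NormedAddCommGroup F] [InnerProductSpace ℝ F]
    {u : F} (hu : ‖u‖ = 1) (h : ℝ) (a b : F) :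
    dist (a + (1 + 2 * (h - ⟪a, u⟫_ℝ)) • u) (b + (1 + 2 * (h - ⟪b, u⟫_ℝ)) • u) = dist a b := by
  rw [dist_eq_norm, dist_eq_norm]
  have he : a + (1 + 2 * (h - ⟪a, u⟫_ℝ)) • u - (b + (1 + 2 * (h - ⟪b, u⟫_ℝ)) • u) =
      (a - b) - (2 * ⟪a - b, u⟫_ℝ) • u := by
    rw [inner_sub_left]
    module
  rw [he]
  have hsq : ‖(a - b) - (2 * ⟪a - b, u⟫_ℝ) • u‖ ^ 2 = ‖a - b‖ ^ 2 := by
    rw [@norm_sub_sq_real, real_inner_smul_right, norm_smul, Real.norm_eq_abs, hu, mul_one,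
      sq_abs]
    ring
  exact (pow_left_inj₀ (norm_nonneg _) (norm_nonneg _) two_ne_zero).1 hsq

/-- **Cross distances are at least `1 + t_a + t_b`.** For `‖u‖ = 1` and any `h`,
`dist a (b + (1 + 2(h - ⟪b, u⟫)) u) ≥ 1 + (h - ⟪a, u⟫) + (h - ⟪b, u⟫)` (minus the
`u`-component of the difference is exactly the right-hand side); useful when `⟪a, u⟫, ⟪b, u⟫ ≤ h`,
where the right-hand side is `≥ 1`. [folklore] -/
theorem surgery_reflect_cross_ge {F : Type*} [NormedAddCommGroup F] [InnerProductSpace ℝ F]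
    {u : F} (hu : ‖u‖ = 1) (h : ℝ) (a b : F) :
    1 + (h - ⟪a, u⟫_ℝ) + (h - ⟪b, u⟫_ℝ) ≤ dist a (b + (1 + 2 * (h - ⟪b, u⟫_ℝ)) • u) := by
  rw [dist_eq_norm]
  set v : F := a - (b + (1 + 2 * (h - ⟪b, u⟫_ℝ)) • u) with hv
  have hvu : ⟪v, u⟫_ℝ = ⟪a, u⟫_ℝ + ⟪b, u⟫_ℝ - 1 - 2 * h := by
    rw [hv, inner_sub_left, inner_add_left, real_inner_smul_left, real_inner_self_eq_norm_sq, hu]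
    ring
  have habs : |⟪v, u⟫_ℝ| ≤ ‖v‖ := by
    have := abs_real_inner_le_norm v u
    rwa [hu, mul_one] at this
  have hneg : -⟪v, u⟫_ℝ ≤ |⟪v, u⟫_ℝ| := neg_le_abs _
  linarith

/-- **A particle faces its own image at distance `1 + 2 t_a`.** [folklore] -/
theorem surgery_reflect_self_dist {F : Type*} [NormedAddCommGroup F] [InnerProductSpace ℝ F]
    {u : F} (hu : ‖u‖ = 1) {h : ℝ} {a : F} (ha : ⟪a, u⟫_ℝ ≤ h) :
    dist a (a + (1 + 2 * (h - ⟪a, u⟫_ℝ)) • u) = 1 + 2 * (h - ⟪a, u⟫_ℝ) := by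
  rw [dist_self_add_right, norm_smul, Real.norm_eq_abs, hu, mul_one, abs_of_nonneg (by linarith)]

/-! ## Reflection doubling -/

/-- **Reflection doubling (supporting-height form, any dimension).** For an injective configuration
`x : Fin N → ℝᵈ`, a unit vector `u`, a height `h ≥ ⟪x_i, u⟫` for all `i`, and `ε ≥ 0`:
`E(N + N) ≤ 2 𝓔(x) + #{i : h ≤ ⟪x_i, u⟫ + ε} · V_LJ(1 + 2ε)`.  The doubled configuration
`x ∪ x'`, `x'_i = x_i + (1 + 2(h - ⟪x_i, u⟫)) u`, is injective with `𝓔(x') = 𝓔(x)`; all cross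
terms are `≤ 0` (cross distances `≥ 1`), and the diagonal cross terms of the cap particles are
`V_LJ(1 + 2 t_i) ≤ V_LJ(1 + 2ε)` (`V_LJ` increasing on `[1, ∞)`). [folklore] -/
theorem surgery_reflectionDoubling_le {x : Fin N → EuclideanSpace ℝ (Fin d)}
    (hx : Function.Injective x) {u : EuclideanSpace ℝ (Fin d)} (hu : ‖u‖ = 1) {h : ℝ}
    (hh : ∀ i, ⟪x i, u⟫_ℝ ≤ h) {ε : ℝ} (hε : 0 ≤ ε) :
    groundStateEnergy lennardJones d (N + N) ≤
      2 * interactionEnergy lennardJones x +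
        ((Finset.univ.filter fun i : Fin N => h ≤ ⟪x i, u⟫_ℝ + ε).card : ℝ) *
          lennardJones (1 + 2 * ε) := by
  classical
  -- the reflected-and-lifted copy `x'`
  set x' : Fin N → EuclideanSpace ℝ (Fin d) :=
    fun i => x i + (1 + 2 * (h - ⟪x i, u⟫_ℝ)) • u with hx'
  have hdd : ∀ i k, dist (x' i) (x' k) = dist (x i) (x k) := fun i k =>
    surgery_reflect_dist_eq hu h (x i) (x k)
  have hcross1 : ∀ i j, 1 ≤ dist (x i) (x' j) := fun i j => by
    have := surgery_reflect_cross_ge hu h (x i) (x j)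
    linarith [hh i, hh j]
  have hne : ∀ i j, x i ≠ x' j := fun i j heq => by
    have := hcross1 i j
    rw [heq, dist_self] at this
    norm_num at this
  have hx'inj : Function.Injective x' := fun a b hab => by
    have h0 : dist (x a) (x b) = 0 := by rw [← hdd, hab, dist_self]
    exact hx (dist_eq_zero.1 h0)
  have hx'E : interactionEnergy lennardJones x' = interactionEnergy lennardJones x := by
    unfold interactionEnergy
    exact Finset.sum_congr rfl fun i _ => Finset.sum_congr rfl fun j _ => by rw [hdd]
  -- the doubled configuration
  set w : Fin (N + N) → EuclideanSpace ℝ (Fin d) := Fin.append x x' with hw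
  have hinj : Function.Injective w := by
    intro a b hab
    induction a using Fin.addCases with
    | left a =>
      induction b using Fin.addCases with
      | left b =>
        simp only [hw, Fin.append_left] at hab
        rw [hx hab]
      | right b =>
        simp only [hw, Fin.append_left, Fin.append_right] at hab
        exact absurd hab (hne a b)
    | right a =>
      induction b using Fin.addCases with
      | left b =>
        simp only [hw, Fin.append_left, Fin.append_right] at hab
        exact absurd hab.symm (hne b a)
      | right b =>
        simp only [hw, Fin.append_right] at hab
        rw [hx'inj hab]
  have hle : groundStateEnergy lennardJones d (N + N) ≤ interactionEnergy lennardJones w :=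
    groundStateEnergy_lennardJones_le hinj
  have hdec := interactionEnergy_append lennardJones lennardJones_zero x x'
  -- the cross sum: off-diagonal terms are `≤ 0`, diagonal terms are priced on the cap
  have hdiag : ∑ i, ∑ j, lennardJones (dist (x i) (x' j)) ≤
      ∑ i, lennardJones (dist (x i) (x' i)) := by
    refine Finset.sum_le_sum fun i _ => ?_
    rw [← Finset.add_sum_erase _ _ (Finset.mem_univ i)]
    have : ∑ j ∈ Finset.univ.erase i, lennardJones (dist (x i) (x' j)) ≤ 0 :=
      Finset.sum_nonpos fun j _ => lennardJones_nonpos (hcross1 i j)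
    linarith
  have hself : ∀ i, dist (x i) (x' i) = 1 + 2 * (h - ⟪x i, u⟫_ℝ) := fun i =>
    surgery_reflect_self_dist hu (hh i)
  have hcap : ∑ i, lennardJones (dist (x i) (x' i)) ≤
      ((Finset.univ.filter fun i : Fin N => h ≤ ⟪x i, u⟫_ℝ + ε).card : ℝ) *
        lennardJones (1 + 2 * ε) := by
    calc ∑ i, lennardJones (dist (x i) (x' i))
        ≤ ∑ i, (if h ≤ ⟪x i, u⟫_ℝ + ε then lennardJones (1 + 2 * ε) else 0) := by
          refine Finset.sum_le_sum fun i _ => ?_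
          rw [hself i]
          split_ifs with hi
          · exact strictMonoOn_lennardJones.monotoneOn
              (Set.mem_Ici.2 (by linarith [hh i])) (Set.mem_Ici.2 (by linarith)) (by linarith)
          · exact lennardJones_nonpos (by linarith [hh i])
      _ = ((Finset.univ.filter fun i : Fin N => h ≤ ⟪x i, u⟫_ℝ + ε).card : ℝ) *
            lennardJones (1 + 2 * ε) := by
          rw [← Finset.sum_filter, Finset.sum_const, nsmul_eq_mul]
  rw [hdec, hx'E] at hle
  linarith

/-- **Reflection doubling** (the statement `ReflectionDoubling` of route `SurfaceTensionNoFoam`,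
item stmt-AtomisticToContinuum-13452, in `ℝ³`): for every injective `N`-configuration `x`, unit
vector `u` and `ε ≥ 0`, `E(2N) ≤ 2 𝓔(x) + m_ε(u) · V_LJ(1 + 2ε)` with
`m_ε(u) = #{i : ⟪x_j, u⟫ ≤ ⟪x_i, u⟫ + ε for all j}` the population of the depth-`ε` cap in
direction `u` (apply `surgery_reflectionDoubling_le` with the supporting height
`h = max_i ⟪x_i, u⟫`). [folklore] -/
theorem surgery_reflectionDoubling :
    ∀ (N : ℕ) (x : Fin N → EuclideanSpace ℝ (Fin 3)), Function.Injective x →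
      ∀ u : EuclideanSpace ℝ (Fin 3), ‖u‖ = 1 → ∀ ε : ℝ, 0 ≤ ε →
        groundStateEnergy lennardJones 3 (2 * N) ≤
          2 * interactionEnergy lennardJones x +
            (Nat.card {i : Fin N // ∀ j : Fin N, inner ℝ (x j) u ≤ inner ℝ (x i) u + ε} : ℝ) *
              lennardJones (1 + 2 * ε) := by
  classical
  intro N x hx u hu ε hε
  rcases Nat.eq_zero_or_pos N with rfl | hN
  · have h0 : groundStateEnergy lennardJones 3 (2 * 0) = 0 :=
      groundStateEnergy_of_le_one lennardJones (by norm_num)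
    have h1 : interactionEnergy lennardJones x = 0 := interactionEnergy_of_subsingleton lennardJones x
    rw [h0, h1, Nat.card_of_isEmpty]
    simp
  · have hne : (Finset.univ : Finset (Fin N)).Nonempty := Finset.univ_nonempty_iff.2 ⟨⟨0, hN⟩⟩
    set hgt : ℝ := Finset.univ.sup' hne fun i => ⟪x i, u⟫_ℝ with hhgt
    have hh : ∀ i, ⟪x i, u⟫_ℝ ≤ hgt := fun i =>
      Finset.le_sup' (fun i => ⟪x i, u⟫_ℝ) (Finset.mem_univ i)
    have key := surgery_reflectionDoubling_le hx hu hh hε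
    have hcard : (Nat.card {i : Fin N // ∀ j : Fin N, inner ℝ (x j) u ≤ inner ℝ (x i) u + ε} : ℝ) =
        ((Finset.univ.filter fun i : Fin N => hgt ≤ ⟪x i, u⟫_ℝ + ε).card : ℝ) := by
      rw [Nat.card_eq_fintype_card, Fintype.card_subtype]
      congr 2
      ext i
      simp only [Finset.mem_filter, Finset.mem_univ, true_and, hhgt, Finset.sup'_le_iff]
      exact ⟨fun H j _ => H j, fun H j => H j trivial⟩
    rw [hcard, two_mul]
    exact key

/-! ## Thin caps of ground states -/

/-- **Caps of a ground state are priced by the excess energy.** For a Lennard-Jones ground state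
`x` of `N` particles in `ℝ³`, every unit vector `u` and `ε ≥ 0`:
`m_ε(u) · |V_LJ(1 + 2ε)| ≤ 2 (E(N) - N e*)`, where `e* = ⨅_Q e(Q)` is the periodic infimum
(reflection doubling, `𝓔(x) = E(N)`, and `E(2N) ≥ 2N e*`). [folklore] -/
theorem surgery_cap_card_mul_le {x : Fin N → EuclideanSpace ℝ (Fin 3)}
    (hx : IsGroundState lennardJones x) {u : EuclideanSpace ℝ (Fin 3)} (hu : ‖u‖ = 1) {ε : ℝ}
    (hε : 0 ≤ ε) :
    (Nat.card {i : Fin N // ∀ j : Fin N, inner ℝ (x j) u ≤ inner ℝ (x i) u + ε} : ℝ) *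
        (-lennardJones (1 + 2 * ε)) ≤
      2 * (groundStateEnergy lennardJones 3 N - (N : ℝ) * eStar) := by
  have key := surgery_reflectionDoubling N x hx.1 u hu ε hε
  rw [hx.2] at key
  rcases Nat.eq_zero_or_pos N with rfl | hN
  · have h0 : groundStateEnergy lennardJones 3 0 = 0 :=
      groundStateEnergy_of_le_one lennardJones (by norm_num)
    rw [Nat.card_of_isEmpty, h0]
    simp
  · have h2N : 0 < 2 * N := by omega
    have hlow := eStar_le_groundStateEnergy_div h2N
    have hpos : (0 : ℝ) < ((2 * N : ℕ) : ℝ) := by exact_mod_cast h2N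
    rw [le_div_iff₀ hpos] at hlow
    push_cast at hlow
    nlinarith [hlow, key]

/-- **Extremal caps of ground states are thin.** For every sequence of Lennard-Jones ground states
`x^N` in `ℝ³`, every `ε > 0` and every sequence of unit vectors `u_N`, the fraction of particles in
the depth-`ε` cap of `x^N` in direction `u_N` tends to `0`:
`#{i : ⟪x^N_j, u_N⟫ ≤ ⟪x^N_i, u_N⟫ + ε ∀ j} / N → 0` (from `surgery_cap_card_mul_le` and
`E(N)/N → e*`).  In particular ground states are not films of bounded thickness in any
direction. [folklore] -/
theorem surgery_cap_density_tendsto_zero (x : (N : ℕ) → Fin N → EuclideanSpace ℝ (Fin 3))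
    (hx : ∀ N, IsGroundState lennardJones (x N)) {ε : ℝ} (hε : 0 < ε)
    (u : ℕ → EuclideanSpace ℝ (Fin 3)) (hu : ∀ N, ‖u N‖ = 1) :
    Tendsto (fun N : ℕ => (Nat.card {i : Fin N // ∀ j : Fin N,
        inner ℝ (x N j) (u N) ≤ inner ℝ (x N i) (u N) + ε} : ℝ) / N) atTop (𝓝 0) := by
  set V : ℝ := -lennardJones (1 + 2 * ε) with hV
  have hVpos : 0 < V := neg_pos.2 (lennardJones_neg (by linarith))
  have hlim : Tendsto (fun N : ℕ => 2 / V * (groundStateEnergy lennardJones 3 N / N - eStar))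
      atTop (𝓝 0) := by
    have h1 : Tendsto (fun N : ℕ => groundStateEnergy lennardJones 3 N / N - eStar) atTop (𝓝 0) := by
      have := crysEnergyLimit.sub_const eStar
      rwa [show (⨅ Q : PeriodicConfiguration 3, Q.energyPerParticle lennardJones) - eStar = 0 from
        sub_self _] at this
    simpa using h1.const_mul (2 / V)
  refine tendsto_of_tendsto_of_tendsto_of_le_of_le' tendsto_const_nhds hlim ?_ ?_
  · exact Eventually.of_forall fun N => div_nonneg (Nat.cast_nonneg _) (Nat.cast_nonneg _)
  · filter_upwards [eventually_gt_atTop 0] with N hN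
    have key := surgery_cap_card_mul_le (hx N) (hu N) hε.le
    have hNr : (0 : ℝ) < N := by exact_mod_cast hN
    rw [div_le_iff₀ hNr]
    have he : 2 / V * (groundStateEnergy lennardJones 3 N / N - eStar) * N =
        2 * (groundStateEnergy lennardJones 3 N - (N : ℝ) * eStar) / V := by
      field_simp
    rw [he, le_div_iff₀ hVpos]
    exact key

/-- **Registered sub-goal `stub_thinCaps` of line `Sketch` (cohesion side, toward `stub_noFoam`):
extremal caps of Lennard-Jones ground states are thin** — for every sequence of ground states,
every `ε > 0` and every sequence of unit directions, the depth-`ε` cap population is `o(N)`.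
[folklore] -/
theorem stub_thinCaps :
    ∀ x : (N : ℕ) → (Fin N → EuclideanSpace ℝ (Fin 3)),
      (∀ N, IsGroundState lennardJones (x N)) → ∀ ε : ℝ, 0 < ε →
        ∀ u : ℕ → EuclideanSpace ℝ (Fin 3), (∀ N, ‖u N‖ = 1) →
          Filter.Tendsto (fun N : ℕ => (Nat.card {i : Fin N // ∀ j : Fin N,
            inner ℝ (x N j) (u N) ≤ inner ℝ (x N i) (u N) + ε} : ℝ) / N) Filter.atTop (nhds 0) :=
  fun x hx _ hε u hu => surgery_cap_density_tendsto_zero x hx hε u hu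

/-! ## Ground states grow thick in every direction -/

/-- **Ground states become thick in every direction, uniformly.** For every sequence of Lennard-Jones
ground states `x^N` in `ℝ³` and every `w`, for all large `N` (a threshold independent of the
direction): in EVERY unit direction `u` two particles of `x^N` have height difference `> w`.
Otherwise all `N` particles lie in the depth-`w` cap of direction `u`, whose population is
`≤ 2(E(N) − N e*)/|V_LJ(1 + 2w)| = o(N)` (`surgery_cap_card_mul_le`, `crysEnergyLimit`).  So
Lennard-Jones ground states are not asymptotically confined to any slab of bounded width: their
minimal width tends to infinity. [folklore] -/
theorem surgery_eventually_width_gt (x : (N : ℕ) → Fin N → EuclideanSpace ℝ (Fin 3))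
    (hx : ∀ N, IsGroundState lennardJones (x N)) (w : ℝ) :
    ∀ᶠ N : ℕ in atTop, ∀ u : EuclideanSpace ℝ (Fin 3), ‖u‖ = 1 →
      ∃ i j : Fin N, w < ⟪x N i - x N j, u⟫_ℝ := by
  classical
  wlog hw : 0 < w generalizing w
  · exact (this 1 one_pos).mono fun N hN u hu => by
      obtain ⟨i, j, hij⟩ := hN u hu
      exact ⟨i, j, by linarith [not_lt.1 hw]⟩
  set V : ℝ := -lennardJones (1 + 2 * w) with hV
  have hVpos : 0 < V := neg_pos.2 (lennardJones_neg (by linarith))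
  have hlim : Tendsto (fun N : ℕ => groundStateEnergy lennardJones 3 N / N - eStar) atTop (𝓝 0) := by
    have := crysEnergyLimit.sub_const eStar
    rwa [show (⨅ Q : PeriodicConfiguration 3, Q.energyPerParticle lennardJones) - eStar = 0 from
      sub_self _] at this
  have hev : ∀ᶠ N : ℕ in atTop, groundStateEnergy lennardJones 3 N / N - eStar < V / 2 :=
    hlim.eventually (gt_mem_nhds (by positivity))
  filter_upwards [hev, eventually_gt_atTop 0] with N hN hN0 u hu
  by_contra hcon
  push Not at hcon
  -- every particle is in the depth-`w` cap of direction `u`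
  have hall : ∀ i j : Fin N, inner ℝ (x N j) u ≤ inner ℝ (x N i) u + w := fun i j => by
    have := hcon j i
    rw [inner_sub_left] at this
    linarith
  have hcard : Nat.card {i : Fin N // ∀ j : Fin N, inner ℝ (x N j) u ≤ inner ℝ (x N i) u + w} = N := by
    rw [Nat.card_eq_fintype_card, Fintype.card_subtype,
      Finset.filter_true_of_mem (fun i _ => hall i), Finset.card_univ, Fintype.card_fin]
  have key := surgery_cap_card_mul_le (hx N) hu hw.le
  rw [hcard] at key
  have hNr : (0 : ℝ) < N := by exact_mod_cast hN0
  have he : (groundStateEnergy lennardJones 3 N / N - eStar) * N =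
      groundStateEnergy lennardJones 3 N - (N : ℝ) * eStar := by
    field_simp
  have h2 : (N : ℝ) * V ≤ 2 * ((groundStateEnergy lennardJones 3 N / N - eStar) * N) := by
    rw [he]
    exact key
  nlinarith

/-- **Registered sub-goal `stub_widthGrows` of line `Sketch` (cohesion side, toward `stub_noFoam`):
Lennard-Jones ground states grow thick in every direction** — for every ground-state sequence and
every `w`, eventually in `N`, every unit direction sees two particles at height difference `> w`.
[folklore] -/
theorem stub_widthGrows :
    ∀ x : (N : ℕ) → (Fin N → EuclideanSpace ℝ (Fin 3)),
      (∀ N, IsGroundState lennardJones (x N)) → ∀ w : ℝ,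
        ∀ᶠ N : ℕ in Filter.atTop, ∀ u : EuclideanSpace ℝ (Fin 3), ‖u‖ = 1 →
          ∃ i j : Fin N, w < inner ℝ (x N i - x N j) u :=
  fun x hx w => surgery_eventually_width_gt x hx w

end Summit.AtomisticToContinuum.Crystallization.Theorems.LjLaminarWindowsSketch

end
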